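import Literature.Computability.Cryptography.InaccessibleEntropyUOWHFInverter
import Literature.Computability.Cryptography.InaccessibleEntropyUOWHFAbstract
import Literature.Computability.Cryptography.InaccessibleEntropyUOWHFFixup
import HarnessLib

/-!
# One-way functions ⇒ UOWHF, machine layer IX: the inverting machine computes the combinatorial finder

Topic `Literature/Computability/Cryptography`; seventeenth file of the "one-way functions ⇒ universal one-way
hash functions" line (Haitner–Holenstein–Reingold–Vadhan–Wee 2020). The run function of the machine
`inverter f q p A₀ A` is the string function `Inv.out` (`InaccessibleEntropyUOWHFInverter.lean`); the
combinatorial analysis speaks of the finder `advA0` of the instance `cand n j f` against the derived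
single-candidate adversary `(targetJR, advJR)` (`InaccessibleEntropyUOWHFAbstract.lean`), whose check-free form is
`rawA0`. This file decodes the coin string and proves that the two agree:

* `finJ`, `finT`, `coinCodec n qn lo` — the code of the coin prefix: grid index, level bits, `x`, `i`, `κ₀`,
  `j₁`, `w`, `g₂`, `g₃`, `ρ`, own chain keys, (all keys, leftover index coins); `coinCodec_len` (= `Inv.pre`);
* the field-by-field decoding `fld'_coin`, and the step-by-step correspondence (`delta`, `kap` = the fix-up of
  `InaccessibleEntropyUOWHFFixup.lean`, `zstr`, `vstr`, `x0s`, `kbP`, `st0`, `yk`, `kb1`, `x1s`, `st1`, `v1`, `xraw`);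
* **`out_coin`**: on coins `code(τ) ++ ω` and challenge `y = f x₀`, `Inv.out = x'` if `f x' = y` else the planted
  `x`, where `x' = rawA0 …` at the decoded grid index `j`, level `r = min(bin rb, R)`, planted point
  `(x, fixup κ₀, i)` and the decoded coins of the finder — hence (`advA0_eq_or`) the machine inverts whenever
  `advA0` does (`inverts_of_advA0`).

All statements proved; no named facts.

## References

* I. Haitner, T. Holenstein, O. Reingold, S. Vadhan, H. Wee, *Inaccessible Entropy II: IE Functions and
  Universal One-Way Hashing*, Theory of Computing 16(8) (2020), Claim 4.6, Lemmas 5.3–5.7, proof of Thm. 5.1.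
-/

namespace Literature.Computability.Cryptography

namespace HHRVW

open _root_.Computability Complexity Complexity.BitCodec AffineStr Sz Finset Polynomial

/-! ### Splices inside concatenations -/

/-- A splice inside the first part of a concatenation. [folklore] -/
theorem splice_append_left {m b : ℕ} {Q A B : List Bool} (hb : (b + 1) * m ≤ A.length) :
    splice m b Q (A ++ B) = splice m b Q A ++ B := by
  rw [splice, splice, List.take_append_of_le_length (by rw [Nat.succ_mul] at hb; omega), List.drop_append_of_le_length hb]
  simp only [List.append_assoc]

/-- **Nested splices**: splicing an `N`-block at fine position `b k + r` of a concatenation of coarse blocks of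
width `k N` is splicing, at coarse position `b`, the coarse block with its `r`-th fine block spliced. [folklore] -/
theorem splice_nested {N k b r : ℕ} {Q l : List Bool} (hr : r + 1 ≤ k) :
    splice N (b * k + r) Q l = splice (k * N) b (splice N r Q ((l.drop (b * (k * N))).take (k * N))) l := by
  have hW : (r + 1) * N ≤ k * N := Nat.mul_le_mul_right _ hr
  have e1 : (b * k + r) * N = b * (k * N) + r * N := by ring
  have e2 : (b * k + r + 1) * N = b * (k * N) + (r + 1) * N := by ring
  rw [splice, splice, splice, e1, e2]
  set W := k * N with hWdef
  have h1 : l.take (b * W + r * N) = l.take (b * W) ++ ((l.drop (b * W)).take W).take (r * N) := by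
    rw [List.take_take, min_eq_left (by rw [Nat.succ_mul] at hW; omega), List.take_add]
  have h2 : l.drop (b * W + (r + 1) * N) = ((l.drop (b * W)).take W).drop ((r + 1) * N) ++ l.drop ((b + 1) * W) := by
    rw [List.drop_take, List.drop_drop, show (b + 1) * W = (b * W + (r + 1) * N) + (W - (r + 1) * N) by rw [Nat.succ_mul]; omega,
      ← List.drop_drop (i := W - (r + 1) * N) (j := b * W + (r + 1) * N), List.take_append_drop]
  rw [h1, h2]; simp only [List.append_assoc]

/-- Appending after a right fold of concatenations. [folklore] -/
theorem foldr_append_append (ps : List (List Bool)) (rest ω : List Bool) :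
    ps.foldr (· ++ ·) rest ++ ω = ps.foldr (· ++ ·) (rest ++ ω) := by
  induction ps with
  | nil => rfl
  | cons a ps ih => rw [List.foldr_cons, List.foldr_cons, List.append_assoc, ih]

/-! ### The code of the coins -/

section Coins

variable (n qn lo : ℕ)

/-- Codec of the grid index `j ∈ Fin (J+1) = Fin (2^{aJ})`. [folklore] -/
def finJ : BitCodec (Fin (Jp1 n)) := finPow (aJ n)

/-- Codec of the planted coordinate `j₁ ∈ Fin t`, `t = 2^{logt}`. [folklore] -/
def finT : BitCodec (Fin (t n)) := ofEquiv (finPow (logt n)) (finCongr (t_eq_pow n).symm)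

/-- Bookkeeping lemma (codec lengths). [folklore] -/
@[simp] theorem finJ_len : (finJ n).len = aJ n := rfl
/-- Bookkeeping lemma (codec lengths). [folklore] -/
@[simp] theorem finT_len : (finT n).len = logt n := rfl
/-- The numeral of the code of `j` is `j`. [folklore] -/
theorem bitsToNat_finJ_enc (j : Fin (Jp1 n)) : bitsToNat ((finJ n).enc j) = j := bitsToNat_finPow_enc (aJ n) j
/-- The numeral of the code of `j₁` is `j₁`. [folklore] -/
theorem bitsToNat_finT_enc (j₁ : Fin (t n)) : bitsToNat ((finT n).enc j₁) = j₁ := by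
  rw [finT, ofEquiv_enc, bitsToNat_finPow_enc]; rfl

/-- The decoded coin prefix, in the order of the layout. [cite: HaitnerEtAl2020, Claim 4.6 with Lemmas 5.3–5.7] -/
abbrev CoinT :=
  Fin (Jp1 n) × (List.Vector Bool (aR n) × (Xv n × (Fin (M n) × (Kv n × (Fin (t n) × (Wv n × (G2v n × (G3v n ×
    (List.Vector Bool qn × ((Fin (R n + 1) → Dv n) × ((Fin (Jp1 n) → Fin (R n + 1) → Dv n) × List.Vector Bool lo)))))))))))

/-- **The code of the coin prefix.** [cite: HaitnerEtAl2020, Claim 4.6 with Lemmas 5.3–5.7] -/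
def coinCodec : BitCodec (CoinT n qn lo) :=
  (finJ n).prod ((BitCodec.vector (aR n)).prod ((BitCodec.vector n).prod ((finM n).prod ((BitCodec.vector (lK n)).prod
    ((finT n).prod ((codecW n).prod ((BitCodec.vector (G2 n)).prod ((BitCodec.vector (G3 n)).prod ((BitCodec.vector qn).prod
    (((zvec (N n)).pi (R n + 1)).prod ((keysCodec n).prod (BitCodec.vector lo))))))))))))

variable {n qn lo}

/-- The twelve codes, as a list. [folklore] -/
def parts (τ : CoinT n qn lo) : List (List Bool) :=
  [(finJ n).enc τ.1, τ.2.1.toList, τ.2.2.1.toList, (finM n).enc τ.2.2.2.1, τ.2.2.2.2.1.toList, (finT n).enc τ.2.2.2.2.2.1,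
    (codecW n).enc τ.2.2.2.2.2.2.1, τ.2.2.2.2.2.2.2.1.toList, τ.2.2.2.2.2.2.2.2.1.toList, τ.2.2.2.2.2.2.2.2.2.1.toList,
    ((zvec (N n)).pi (R n + 1)).enc τ.2.2.2.2.2.2.2.2.2.2.1,
    (keysCodec n).enc τ.2.2.2.2.2.2.2.2.2.2.2.1 ++ τ.2.2.2.2.2.2.2.2.2.2.2.2.toList]

/-- The code is the concatenation of the parts. [folklore] -/
theorem coinCodec_enc (τ : CoinT n qn lo) : (coinCodec n qn lo).enc τ = (parts τ).foldr (· ++ ·) [] := by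
  simp only [coinCodec, prod_enc, vector_enc, parts, List.foldr_cons, List.foldr_nil, List.append_nil]

/-- Reading field `k` of a concatenation of parts with lengths `ls`. [folklore] -/
theorem fld_foldr_parts : ∀ (ps : List (List Bool)) (rest : List Bool) (ls : List ℕ) (hls : ps.map List.length = ls) (k : ℕ)
    (hk : k < ls.length), fld (ps.foldr (· ++ ·) rest) ((ls.take k).sum) (ls[k]) = ps[k]'(by rw [← hls, List.length_map] at hk; exact hk)
  | [], _, ls, hls, k, hk => by subst hls; simp at hk
  | a :: ps, rest, ls, hls, 0, hk => by
    subst hls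
    simp [fld, List.take_left']
  | a :: ps, rest, ls, hls, k + 1, hk => by
    subst hls
    have ih := fld_foldr_parts ps rest (ps.map List.length) rfl k (by simpa using hk)
    simp only [List.map_cons, List.take_succ_cons, List.sum_cons, List.foldr_cons, List.getElem_cons_succ]
    rw [fld, ← List.drop_drop, List.drop_left, ← fld, ih]

/-- The remainder after the parts. [folklore] -/
theorem drop_foldr_parts : ∀ (ps : List (List Bool)) (rest : List Bool), (ps.foldr (· ++ ·) rest).drop (ps.map List.length).sum = rest
  | [], rest => rfl
  | a :: ps, rest => by
    rw [List.map_cons, List.sum_cons, List.foldr_cons, ← List.drop_drop, List.drop_left, drop_foldr_parts ps rest]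

variable {q p : Polynomial ℕ}

/-- The lengths of the parts are the layout (`qn = q(n)`, `K + lo = p(n)`). [folklore] -/
theorem map_length_parts (hlo : K n + lo = p.eval n) (hq : qn = q.eval n) (τ : CoinT n qn lo) : (parts τ).map List.length = Inv.L n q p := by
  have hW : ∀ w : Wv n, ((codecW n).enc w).length = t n * d0 n := fun w => (codecW n).length_enc w
  have hY : ∀ y : Fin (R n + 1) → Dv n, (((zvec (N n)).pi (R n + 1)).enc y).length = (R n + 1) * N n := fun y => by
    rw [((zvec (N n)).pi (R n + 1)).length_enc, pi_len, zvec_len]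
  have hKl : ∀ k : Fin (Jp1 n) → Fin (R n + 1) → Dv n, ((keysCodec n).enc k).length = K n := fun k => by
    rw [(keysCodec n).length_enc, keysCodec_len]
  rw [Inv.L_eq]
  simp only [parts, List.map_cons, List.map_nil, (finJ n).length_enc, finJ_len, List.Vector.toList_length, (finM n).length_enc,
    finM_len, (finT n).length_enc, finT_len, hW, List.length_append, hY, hKl, hlo, Inv.len, hq]

/-- `|code| = pre`. [folklore] -/
theorem coinCodec_len (hlo : K n + lo = p.eval n) (hq : qn = q.eval n) : (coinCodec n qn lo).len = Inv.pre n q p := by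
  simp only [coinCodec, prod_len, finJ_len, vector_len, finM_len, finT_len, codecW_len, pi_len, zvec_len, keysCodec_len, Inv.pre, Inv.L_eq,
    List.sum_cons, List.sum_nil, Inv.len]
  omega

/-- **Field `k` of the coins `code(τ) ++ ω` is part `k`.** [folklore] -/
theorem fld'_coin (hlo : K n + lo = p.eval n) (hq : qn = q.eval n) (τ : CoinT n qn lo) (ω : List Bool) {k : ℕ} (hk : k < 12) :
    Inv.fld' n q p ((coinCodec n qn lo).enc τ ++ ω) k = (parts τ)[k]'(by rw [show (parts τ).length = 12 from rfl]; exact hk) := by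
  have hk' : k < (Inv.L n q p).length := by rw [Inv.length_L]; exact hk
  rw [Inv.fld', Inv.off, ← Inv.getElem_L n q p hk', coinCodec_enc, foldr_append_append, List.nil_append]
  exact fld_foldr_parts (parts τ) ω (Inv.L n q p) (map_length_parts hlo hq τ) k hk'

/-- The coins of `A` are `ω`. [folklore] -/
theorem ω_coin (hlo : K n + lo = p.eval n) (hq : qn = q.eval n) (τ : CoinT n qn lo) (ω : List Bool) :
    Inv.ω n q p ((coinCodec n qn lo).enc τ ++ ω) = ω := by
  rw [Inv.ω, Inv.pre, ← map_length_parts hlo hq τ, coinCodec_enc, foldr_append_append, List.nil_append, drop_foldr_parts]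

end Coins

/-! ### The run of the machine on coded coins -/

section Run

/-- `a - b = a + b` in `𝔽₂^N`. [folklore] -/
theorem Dv_sub_eq_add {n : ℕ} (a b : Dv n) : a - b = a + b := by
  funext m; rw [Pi.sub_apply, Pi.add_apply, sub_eq_add_neg, ZMod.neg_eq_self_mod_two]

/-- The level read off the level bits. [cite: HaitnerEtAl2020, Lemma 5.7] -/
def rOfBits (n : ℕ) (rb : List Bool) : Fin (R n + 1) := ⟨min (bitsToNat rb) (R n), Nat.lt_succ_of_le (min_le_right _ _)⟩

/-- The fixed-up key of the planted point, as a vector. [cite: HaitnerEtAl2020, Claim 4.6] -/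
def κfix (n : ℕ) (f : List Bool → List Bool) (x₀ x : Xv n) (κ₀ : Kv n) (i : ℕ) : Kv n :=
  (BitCodec.vector (lK n)).dec (fixupStr n κ₀.toList (List.zipWith xor (f x₀.toList) (f x.toList)) i)

/-- `(κfix …).toList` is the string fix-up. [folklore] -/
theorem κfix_toList {n : ℕ} {f : List Bool → List Bool} (hf : IsLengthPreserving f) (x₀ x : Xv n) (κ₀ : Kv n) (i : ℕ) :
    (κfix n f x₀ x κ₀ i).toList = fixupStr n κ₀.toList (List.zipWith xor (f x₀.toList) (f x.toList)) i :=
  vector_dec_toList _ (length_fixupStr (List.Vector.toList_length κ₀)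
    (by rw [List.length_zipWith, hf, hf, List.Vector.toList_length, List.Vector.toList_length, min_self]) i)

variable {n : ℕ} {q p : Polynomial ℕ} {lo : ℕ} {f : List Bool → List Bool} {A₀ : List Bool → List Bool} {A : RandAlg (List Bool) (List Bool)}
variable (hf : IsLengthPreserving f) (hlo : K n + lo = p.eval n)
include hf hlo

/-- **The run of the inverter on coded coins**: with `y = f x₀` and coins `code(τ) ++ ω`, the machine returns the
check-free finder's answer `x' = rawA0 …` (at the decoded `j`, `r`, planted `(x, fixup κ₀, i)`) if `f x' = y`, and
the planted `x` otherwise. [cite: HaitnerEtAl2020, Claim 4.6 with Lemmas 5.3–5.7] -/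
theorem out_coin {κA : ℕ} (τ : CoinT n (q.eval n) lo) (ωv : List.Vector Bool κA) (x₀ : Xv n) :
    Inv.out f n q p A₀ A ((coinCodec n (q.eval n) lo).enc τ ++ ωv.toList) (f x₀.toList) =
      let x := τ.2.2.1
      let x' := rawA0 f n (q.eval n) lo κA A₀ A τ.1 (rOfBits n τ.2.1.toList) x (κfix n f x₀ x τ.2.2.2.2.1 τ.2.2.2.1) τ.2.2.2.1
        (τ.2.2.2.2.2.1, τ.2.2.2.2.2.2.1, (τ.2.2.2.2.2.2.2.1, (τ.2.2.2.2.2.2.2.2.1,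
          ((τ.2.2.2.2.2.2.2.2.2.2.1, (τ.2.2.2.2.2.2.2.2.2.2.2.1, (τ.2.2.2.2.2.2.2.2.2.1, τ.2.2.2.2.2.2.2.2.2.2.2.2))), ωv))))
      if f x'.toList = f x₀.toList then x'.toList else x.toList := by
  rcases τ with ⟨jv, rb, x, iv, κ₀, j₁, w, g₂, g₃, ρ, ysj, keys, lov⟩
  simp only
  set c := (coinCodec n (q.eval n) lo).enc (jv, rb, x, iv, κ₀, j₁, w, g₂, g₃, ρ, ysj, keys, lov) ++ ωv.toList with hc
  have hq : q.eval n = q.eval n := rfl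
  -- the fields
  have F := fun k (hk : k < 12) => fld'_coin (q := q) hlo hq (jv, rb, x, iv, κ₀, j₁, w, g₂, g₃, ρ, ysj, keys, lov) ωv.toList hk
  have F0 : Inv.fld' n q p c 0 = (finJ n).enc jv := F 0 (by norm_num)
  have F1 : Inv.fld' n q p c 1 = rb.toList := F 1 (by norm_num)
  have F2 : Inv.fld' n q p c 2 = x.toList := F 2 (by norm_num)
  have F3 : Inv.fld' n q p c 3 = (finM n).enc iv := F 3 (by norm_num)
  have F4 : Inv.fld' n q p c 4 = κ₀.toList := F 4 (by norm_num)
  have F5 : Inv.fld' n q p c 5 = (finT n).enc j₁ := F 5 (by norm_num)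
  have F6 : Inv.fld' n q p c 6 = (codecW n).enc w := F 6 (by norm_num)
  have F7 : Inv.fld' n q p c 7 = g₂.toList := F 7 (by norm_num)
  have F8 : Inv.fld' n q p c 8 = g₃.toList := F 8 (by norm_num)
  have F9 : Inv.fld' n q p c 9 = ρ.toList := F 9 (by norm_num)
  have F10 : Inv.fld' n q p c 10 = ((zvec (N n)).pi (R n + 1)).enc ysj := F 10 (by norm_num)
  have F11 : Inv.fld' n q p c 11 = (keysCodec n).enc keys ++ lov.toList := F 11 (by norm_num)
  have Fω : Inv.ω n q p c = ωv.toList := ω_coin hlo hq _ _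
  -- the scalars
  have hj : Inv.jOf n q p c = jv := by rw [Inv.jOf, F0, bitsToNat_finJ_enc, min_eq_left jv.isLt.le]
  have hr : Inv.rOf n q p c = rOfBits n rb.toList := by rw [Inv.rOf, F1]; rfl
  have hi : Inv.iOf n q p c = iv := by rw [Inv.iOf, F3, bitsToNat_finM_enc, min_eq_left iv.isLt.le]
  have hj1 : Inv.j1 n q p c = j₁ := by rw [Inv.j1, F5, bitsToNat_finT_enc, min_eq_left j₁.isLt.le]
  let r := rOfBits n rb.toList
  let κf := κfix n f x₀ x κ₀ iv
  -- abbreviations of the abstract data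
  let c' : CoinsJR n (q.eval n) lo := (ysj, (keys, (ρ, lov)))
  let v : (Wv n × G2v n) × G3v n := ((Function.update w j₁ (x, κf, iv), g₂), g₃)
  let tJR := targetJR f n (q.eval n) lo A₀ jv r c'
  let ykA : Dv n := (cand n jv f).e.symm v - tJR
  let aJR := advJR f n (q.eval n) lo κA A jv r ykA c' ωv
  -- Step: δ and the fixed-up key
  have hkap : Inv.kap f n q p c (f x₀.toList) = κf.toList := by
    rw [Inv.kap, Inv.κ0, F4, Inv.delta, Inv.xs, F2, hi, κfix_toList hf]
  -- Step: the planted point and the `F₃`-input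
  have hz : Inv.zstr f n q p c (f x₀.toList) = (codecD n).enc (x, κf, iv) := by
    rw [Inv.zstr, Inv.xs, F2, hkap, F3, codecD_enc]
  have hvstr : Inv.vstr f n q p c (f x₀.toList) = (codecIn3 n).enc v := by
    rw [Inv.vstr, hz, hj1, F6, F7, F8, codecIn3, prod_enc, codecIn2, prod_enc, vector_enc, vector_enc, codecW,
      pi_enc_update, codecD_len]
  -- Step: the target and its level-`r` state
  have hx0 : Inv.x0s n q p A₀ c = (inCodec n).enc (targetAbs n (q.eval n) A₀ ρ) := by
    rw [Inv.x0s, F9, targetAbs, (inCodec n).enc_dec _ (by rw [length_fitLen, inCodec_len])]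
  have hkeys' : ∀ yv : Fin (R n + 1) → Dv n,
      splice ((R n + 1) * N n) jv (((zvec (N n)).pi (R n + 1)).enc yv) ((keysCodec n).enc keys ++ lov.toList) =
        (keysCodec n).enc (Function.update keys jv yv) ++ lov.toList := fun yv => by
    have hKl : ((keysCodec n).enc keys).length = K n := by rw [(keysCodec n).length_enc, keysCodec_len]
    rw [splice_append_left (by rw [hKl, K, mul_assoc]; exact Nat.mul_le_mul_right _ jv.isLt), keysCodec, pi_enc_update, pi_len, zvec_len]
  have hkbP : Inv.kbP n q p c = (keysCodec n).enc (Function.update keys jv ysj) ++ lov.toList := by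
    rw [Inv.kbP, hj, F10, F11, hkeys']
  have hK : K n ≤ p.eval n := by omega
  have hst0 : Inv.st0 f n q p A₀ c = (zvec (N n)).enc tJR := by
    rw [Inv.st0, hj, hkbP, hx0, hr, chainSt_enc hf (Function.update keys jv ysj) lov.toList jv.isLt (targetAbs n (q.eval n) A₀ ρ)
      (show (r : ℕ) ≤ R n from Nat.le_of_lt_succ r.isLt), Fin.eta, Function.update_self]
    rfl
  -- Step: the challenge key
  have hev : (cand n jv f).e.symm v = eInv n v := by
    rw [Equiv.symm_apply_eq, cand_e_apply]; exact (eFun_eInv n v).symm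
  have hev' : (zvec (N n)).enc (eInv n v) = (codecIn3 n).enc v :=
    (zvec (N n)).enc_dec ((codecIn3 n).enc v) (by rw [(codecIn3 n).length_enc, codecIn3_len, zvec_len])
  have hyk : Inv.yk f n q p A₀ c (f x₀.toList) = (zvec (N n)).enc ykA := by
    rw [Inv.yk, hvstr, hst0, ← hev', zvec_enc, zvec_enc, zipWith_xor_encZ, ← Dv_sub_eq_add, ← hev, zvec_enc]
  -- Step: the keys with the challenge planted
  have hkb1 : Inv.kb1 f n q p A₀ c (f x₀.toList) = (keysCodec n).enc (Function.update keys jv (Function.update ysj r ykA)) ++ lov.toList := by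
    have hKl : ((keysCodec n).enc (Function.update keys jv ysj)).length = K n := by rw [(keysCodec n).length_enc, keysCodec_len]
    have hcoarse : ((jv : ℕ) + 1) * ((R n + 1) * N n) ≤ K n := by rw [K, mul_assoc]; exact Nat.mul_le_mul_right _ jv.isLt
    have hfine : ((jv : ℕ) * (R n + 1) + r + 1) * N n ≤ K n := by
      have h1 : ((jv : ℕ) * (R n + 1) + r) + 1 ≤ Jp1 n * (R n + 1) := by
        calc ((jv : ℕ) * (R n + 1) + r) + 1 ≤ jv * (R n + 1) + (R n + 1) := by have := r.isLt; omega
          _ = ((jv : ℕ) + 1) * (R n + 1) := by ring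
          _ ≤ Jp1 n * (R n + 1) := Nat.mul_le_mul_right _ jv.isLt
      calc ((jv : ℕ) * (R n + 1) + r + 1) * N n ≤ (Jp1 n * (R n + 1)) * N n := Nat.mul_le_mul_right _ h1
        _ = K n := by rw [K]
    have hblk : (((keysCodec n).enc (Function.update keys jv ysj)).drop (jv * ((R n + 1) * N n))).take ((R n + 1) * N n) =
        ((zvec (N n)).pi (R n + 1)).enc ysj := by
      have := pi_enc_block ((zvec (N n)).pi (R n + 1)) (Jp1 n) (Function.update keys jv ysj) jv
      rw [pi_len, zvec_len, Function.update_self] at this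
      exact this
    have hL : splice (N n) (jv * (R n + 1) + r) ((zvec (N n)).enc ykA) ((keysCodec n).enc (Function.update keys jv ysj)) =
        splice ((R n + 1) * N n) jv (splice (N n) r ((zvec (N n)).enc ykA) (((zvec (N n)).pi (R n + 1)).enc ysj))
          ((keysCodec n).enc (Function.update keys jv ysj)) := by
      rw [← hblk]
      exact splice_nested (Nat.succ_le_of_lt r.isLt)
    have hR : (keysCodec n).enc (Function.update keys jv (Function.update ysj r ykA)) =
        splice ((R n + 1) * N n) jv (splice (N n) r ((zvec (N n)).enc ykA) (((zvec (N n)).pi (R n + 1)).enc ysj))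
          ((keysCodec n).enc (Function.update keys jv ysj)) := by
      rw [← Function.update_idem ysj (Function.update ysj r ykA) keys, keysCodec, pi_enc_update, pi_enc_update, pi_len, zvec_len]
    rw [Inv.kb1, hj, hr, hyk, hkbP, splice_append_left (by rw [hKl]; exact hfine), hL, hR]
  -- Step: the index and the answer of `A`
  have hsIdx : Inv.sIdx f n q p A₀ c (f x₀.toList) = indexStr n (Function.update keys jv (Function.update ysj r ykA)) lov.toList := by
    rw [Inv.sIdx, hkb1, indexStr]
  have hx1 : Inv.x1s f n q p A₀ A c (f x₀.toList) =
      (inCodec n).enc (advJ n (q.eval n) lo κA A jv (Function.update ysj r ykA) (keys, (ρ, lov)) ωv) := by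
    rw [Inv.x1s, hsIdx, F9, Fω, advJ, advAbs, (inCodec n).enc_dec _ (by rw [length_fitLen, inCodec_len])]
  -- Step: the level-`r` state of the answer
  have hst1 : Inv.st1 f n q p A₀ A c (f x₀.toList) = (zvec (N n)).enc aJR := by
    rw [Inv.st1, hj, hkb1, hx1, hr, chainSt_enc hf (Function.update keys jv (Function.update ysj r ykA)) lov.toList jv.isLt
      (advJ n (q.eval n) lo κA A jv (Function.update ysj r ykA) (keys, (ρ, lov)) ωv) (show (r : ℕ) ≤ R n from Nat.le_of_lt_succ r.isLt),
      Fin.eta, Function.update_self]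
    rfl
  have hv1 : Inv.v1 f n q p A₀ A c (f x₀.toList) = (zvec (N n)).enc (ykA + aJR) := by
    rw [Inv.v1, hyk, hst1, zvec_enc, zvec_enc, zipWith_xor_encZ, zvec_enc]
  -- Step: reading the planted coordinate back
  have hcoord : ∀ (s : List Bool), s.length = N n →
      ((((codecIn3 n).dec s).1.1 j₁).1).toList = (s.drop (j₁ * d0 n)).take n := by
    intro s hs
    have hnd : n ≤ d0 n := by rw [d0]; omega
    have hj₁ : (j₁ : ℕ) * d0 n + n ≤ t n * d0 n := by
      have := Nat.mul_le_mul_right (d0 n) (Nat.succ_le_of_lt j₁.isLt); rw [Nat.succ_mul] at this; omega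
    have hN : t n * d0 n ≤ N n := by rw [N, n2]; omega
    simp only [codecIn3, codecIn2, codecW, codecD, prod_dec, pi_dec, ofEquiv_dec, Equiv.prodAssoc_apply, prod_len, vector_len,
      ofEquiv_len, pi_len, finM_len, show n + lK n + a n = d0 n from rfl]
    rw [List.take_take, min_eq_left (Nat.le_add_right _ _), List.take_take, min_eq_left hnd, List.take_take,
      min_eq_left (Nat.le_add_right _ _), List.drop_take, List.take_take, min_eq_left (by omega)]
    exact vector_dec_toList n (by rw [List.length_take, List.length_drop, hs, min_eq_left]; omega)
  have hxraw : Inv.xraw f n q p A₀ A c (f x₀.toList) =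
      (rawA0 f n (q.eval n) lo κA A₀ A jv r x κf iv (j₁, w, (g₂, (g₃, (c', ωv))))).toList := by
    rw [Inv.xraw, hv1, hj1]
    show _ = ((eFun n (ykA + aJR)).1.1 j₁).1.toList
    rw [eFun, hcoord _ (by rw [(zvec (N n)).length_enc, zvec_len])]
  rw [Inv.out, hxraw, Inv.xs, F2]

omit hlo in
/-- **The machine inverts whenever `advA0` does**: `[f(advA0 …) = f x₀] ≤ [f(machine output) = f x₀]`.
[cite: HaitnerEtAl2020, Claim 4.6] -/
theorem inverts_of_advA0 (hlo : K n + lo = p.eval n) {κA : ℕ} (τ : CoinT n (q.eval n) lo) (ωv : List.Vector Bool κA) (x₀ : Xv n)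
    (h : f ((cand n τ.1 f).advA0 (targetJR f n (q.eval n) lo A₀ τ.1 (rOfBits n τ.2.1.toList))
        (advJR f n (q.eval n) lo κA A τ.1 (rOfBits n τ.2.1.toList)) τ.2.2.1 (κfix n f x₀ τ.2.2.1 τ.2.2.2.2.1 τ.2.2.2.1) τ.2.2.2.1
        (τ.2.2.2.2.2.1, τ.2.2.2.2.2.2.1, (τ.2.2.2.2.2.2.2.1, (τ.2.2.2.2.2.2.2.2.1,
          ((τ.2.2.2.2.2.2.2.2.2.2.1, (τ.2.2.2.2.2.2.2.2.2.2.2.1, (τ.2.2.2.2.2.2.2.2.2.1, τ.2.2.2.2.2.2.2.2.2.2.2.2))), ωv))))).toList =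
      f x₀.toList) :
    f (Inv.out f n q p A₀ A ((coinCodec n (q.eval n) lo).enc τ ++ ωv.toList) (f x₀.toList)) = f x₀.toList := by
  rw [out_coin hf hlo τ ωv x₀]
  simp only
  split_ifs with hx'
  · exact hx'
  · -- then `advA0` returned the planted `x`, and `f x = f x₀`
    rcases advA0_eq_or f n (q.eval n) lo κA A₀ A τ.1 (rOfBits n τ.2.1.toList) τ.2.2.1 (κfix n f x₀ τ.2.2.1 τ.2.2.2.2.1 τ.2.2.2.1) τ.2.2.2.1
      (τ.2.2.2.2.2.1, τ.2.2.2.2.2.2.1, (τ.2.2.2.2.2.2.2.1, (τ.2.2.2.2.2.2.2.2.1,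
        ((τ.2.2.2.2.2.2.2.2.2.2.1, (τ.2.2.2.2.2.2.2.2.2.2.2.1, (τ.2.2.2.2.2.2.2.2.2.1, τ.2.2.2.2.2.2.2.2.2.2.2.2))), ωv)))) with h1 | h1
    · rw [h1] at h; exact h
    · rw [h1] at h; exact absurd h hx'

end Run

end HHRVW

end Literature.Computability.Cryptography
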